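import Literature.NumberTheory.GaloisRepresentations.LubinTateColemanLevel
import Literature.NumberTheory.GaloisRepresentations.LubinTateColemanNormCoherent
import Literature.NumberTheory.GaloisRepresentations.LubinTateColemanZeros
import HarnessLib

/-!
# Coleman's interpolation theorem (de Shalit I §2.2): norm-coherent units are the values of a
unique `𝒩`-invariant power series at a generator of the Tate module

De Shalit, *Iwasawa theory of elliptic curves with complex multiplication* (1987), Ch. I §2.2,
**Theorem** (R. Coleman, *Division values in local fields*, Invent. Math. 53 (1979), Thm. A), in the
absolute case `k' = k = F` for the Lubin–Tate group of `f = πX + X^q` over a non-archimedean local field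
`F` of any residue characteristic: let `ω_{m+1} ∈ 𝔪_{K_π^{m+1}}` be a generator of the Tate module
(`cohPt hπ m`, `[π] ω_{m+2} = ω_{m+1}`) and let `β = (β_m)`, `β_m ∈ 𝒪_{K_π^{m+1}}ˣ`, be NORM-COHERENT:
`N_{K_π^{m+1}/K_π^{n+1}}(β_m) = β_n` for `n ≤ m` — here the relative norm is written as the product of
`σ β_m` over `Gal(K_π^{m+1}/K_π^{n+1}) = {σ ∈ Gal(K_π^{m+1}/F) : σ ω_{n+1} = ω_{n+1}}`. Then **there is a
unique `g ∈ 𝒪_F⟦X⟧` with `g(ω_{m+1}) = β_m` for all `m`, and `𝒩 g = g`** (`exists_evalAt_cohPt_eq`,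
`eq_of_forall_evalAt_cohPt_eq`). Everything is **proved**; the proof is de Shalit's: choose
`h_m ∈ 𝒪_F⟦X⟧ˣ` with `h_m(ω_{m+1}) = β_m`, put `g_m = 𝒩^{(m)} h_m`; by the relative form of (2)
(`prod_stabilizer_algEquiv_evalAt`) and the congruence (3) (`colemanNormIter_sub_one_mem`),
`‖g_m(ω_{n+1}) - β_n‖ ≤ ‖π‖^{m-n+1}` (`norm_evalAt_colemanNormIter_sub_le`); a cluster point `g` of
`(g_m)` for the compact product topology of `𝒪_F^ℕ` (Mathlib: `CompactSpace 𝒪[F]`, Tychonoff) then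
satisfies `g(ω_{n+1}) = β_n` (evaluation is continuous in that topology,
`norm_evalAt_sub_le_of_forall_lt`), and `𝒩 g = g` because `𝒩g - g` vanishes at every `ω_{n+1}` (again by
(2) and norm-coherence) and a non-zero series has only finitely many such zeros
(`LubinTateColemanZeros.lean`); `𝒩` does not depend on the level (`colemanNorm_level_eq`).

## Contents

* `dvd_sub_mem_nhds` — `{z : π^a ∣ z - z₀}` is a neighbourhood of `z₀` in `𝒪_F`; `exists_frequently_close`
  — a cluster point of a sequence in `𝒪_F^ℕ` is, frequently, congruent to it modulo `π^a` in the first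
  `K` coordinates.
* `norm_evalAt_colemanNormIter_sub_le` — de Shalit's (2)+(3): `‖(𝒩^{(m)} h_m)(ω_{n+1}) - β_n‖ ≤ ‖π‖^{m-n+1}`.
* ★ `exists_evalAt_cohPt_eq` — **existence** of the interpolating series, with `𝒩 g = g`
  (`colemanNorm hπ 0 g = g`; any level by `colemanNorm_level_eq`).
* `eq_of_forall_evalAt_cohPt_eq` — **uniqueness**.

## References

* E. de Shalit, *Iwasawa theory of elliptic curves with complex multiplication* (1987), Ch. I §2.2
  Theorem and its proof ((2), (3), compactness, Weierstrass preparation). [cite: deShalit1987, Ch. I §2.2 Theorem]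
* R. Coleman, *Division values in local fields*, Invent. Math. 53 (1979), Thm. A.

## Mathlib reuse

`exists_clusterPt_of_compactSpace` (with `CompactSpace 𝒪[K]` for `IsNonarchimedeanLocalField`, Tychonoff
`Pi.compactSpace`), `mapClusterPt_iff_frequently`, `Filter.Frequently.and_eventually`,
`IsValuativeTopology.mem_nhds_iff'`, `Filter.biInter_finset_mem`, `Valuation.Integers.le_iff_dvd`,
`exists_pow_lt_of_lt_one`, `IsUltrametricDist.norm_add_le_max`; from the tree: `LubinTateColemanLevel.lean`,
`LubinTateColemanNormCoherent.lean`, `LubinTateColemanZeros.lean`, `LubinTateTowerGenerator.lean`,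
`LubinTateNormOperator.lean`, `LubinTateCharacterLimit.lean`.
-/

noncomputable section

open Filter Topology Polynomial ValuativeRel
open scoped PowerSeries.WithPiTopology

namespace Literature.NumberTheory.GaloisRepresentations

section LocalFieldI

open GaloisRepresentations.IsNonarchimedeanLocalField LubinTate

variable (F : Type*) [Field F] [ValuativeRel F] [TopologicalSpace F] [IsNonarchimedeanLocalField F]

attribute [local instance] ltNormUniformSpace ltNormIsUniformAddGroup rk1 nF nE fintypeResidueField

variable {F}
variable {π : 𝒪[F]} (hπ : (valuation F).IsUniformizer (π : F))

/-! ### Neighbourhoods in `𝒪_F` and `𝒪_F^ℕ` -/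

include hπ in
/-- **`{z : π^a ∣ z - z₀}` is a neighbourhood of `z₀` in `𝒪_F`** (it contains the valuation ball
`v(z - z₀) < v(π)^a`). [cite: SerreLocalFields1979, Ch. II §1] -/
theorem dvd_sub_mem_nhds (a : ℕ) (z₀ : 𝒪[F]) : {z : 𝒪[F] | π ^ a ∣ z - z₀} ∈ 𝓝 z₀ := by
  have hπ0 : valuation F (π : F) ≠ 0 := (Valuation.ne_zero_iff _).mpr hπ.ne_zero
  set γ : (ValueGroupWithZero F)ˣ := Units.mk0 (valuation F (π : F) ^ a) (pow_ne_zero _ hπ0) with hγ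
  have hV : {w : F | valuation F (w - (z₀ : F)) < γ} ∈ 𝓝 (z₀ : F) :=
    IsValuativeTopology.mem_nhds_iff'.mpr ⟨γ, subset_rfl⟩
  have hV' := continuous_subtype_val.continuousAt.preimage_mem_nhds hV
  refine Filter.mem_of_superset hV' fun z hz => ?_
  have hz' : valuation F ((z : F) - (z₀ : F)) < valuation F (π : F) ^ a := hz
  have hle : valuation F (((z - z₀ : 𝒪[F]) : F)) ≤ valuation F (((π ^ a : 𝒪[F]) : F)) := by
    rw [AddSubgroupClass.coe_sub, SubmonoidClass.coe_pow, map_pow]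
    exact hz'.le
  exact (Valuation.Integers.le_iff_dvd (Valuation.integer.integers (valuation F))).mp hle

include hπ in
/-- **A cluster point of a sequence in `𝒪_F^ℕ` (product topology) is frequently close to it**:
congruent modulo `π^a` in the coordinates `< K`, for infinitely many indices.
[cite: deShalit1987, Ch. I §2.2 (proof, "a limit point")] -/
theorem exists_frequently_close {c : ℕ → ℕ → 𝒪[F]} {x : ℕ → 𝒪[F]} (hx : MapClusterPt x atTop c)
    (K a : ℕ) : ∃ᶠ m in atTop, ∀ k < K, π ^ a ∣ c m k - x k := by
  have hS : {y : ℕ → 𝒪[F] | ∀ k < K, π ^ a ∣ y k - x k} ∈ 𝓝 x := by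
    have e : {y : ℕ → 𝒪[F] | ∀ k < K, π ^ a ∣ y k - x k} =
        ⋂ k ∈ Finset.range K, (fun y : ℕ → 𝒪[F] => y k) ⁻¹' {z | π ^ a ∣ z - x k} := by
      ext y
      simp only [Set.mem_setOf_eq, Set.mem_iInter, Set.mem_preimage, Finset.mem_range]
    rw [e, Filter.biInter_finset_mem]
    exact fun k _ => (continuous_apply k).continuousAt.preimage_mem_nhds (dvd_sub_mem_nhds hπ a (x k))
  exact mapClusterPt_iff_frequently.mp hx _ hS

/-! ### De Shalit's (2) + (3): `‖(𝒩^{(m)} h_m)(ω_{n+1}) - β_n‖ ≤ ‖π‖^{m-n+1}` -/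

open scoped Classical in
/-- **De Shalit's (2)+(3)**: if `h ∈ 𝒪_F⟦X⟧` has unit constant term and `y = h(ω_{m+1})`, and
`∏_{σ : σ ω_{n+1} = ω_{n+1}} σ y = y'` in `K_π^{m+1}` (`n ≤ m`), then
`‖(𝒩^{(m)} h)(ω_{n+1}) - y'‖ ≤ ‖π‖^{m-n+1}`: indeed `𝒩^{(m)} h = 𝒩^{(m-n)} h · 𝒩^{(m-n)}(𝒩^{(n)}h/h)` with
`(𝒩^{(m-n)} h)(ω_{n+1}) = y'` by (2) and `𝒩^{(m-n)}(𝒩^{(n)}h/h) ≡ 1 (mod π^{m-n+1})` by (i), (iv).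
[cite: deShalit1987, Ch. I §2.2 (proof, (2)–(3))] -/
theorem norm_evalAt_colemanNormIter_sub_le {n m : ℕ} (hnm : n ≤ m) {h : PowerSeries (LTCoeff F)}
    (hh : IsUnit (PowerSeries.constantCoeff h)) {y' : ltField π m}
    (hy' : ∏ σ ∈ Finset.univ.filter (fun σ : ltField π m ≃ₐ[F] ltField π m =>
        mapPt σ (inclPt (ltField_mono hπ hnm) (cohPt hπ n)) = inclPt (ltField_mono hπ hnm) (cohPt hπ n)),
        σ ((evalAt (maxNilIdeal F (ltField π m)) (cohPt hπ m) h : unitBall (ltField π m)) : ltField π m) = y') :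
    ‖((evalAt (maxNilIdeal F (ltField π m)) (inclPt (ltField_mono hπ hnm) (cohPt hπ n))
        (colemanNormIter hπ m m h) : unitBall (ltField π m)) : ltField π m) - y'‖ ≤
      ‖(π : F)‖ ^ (m - n + 1) := by
  have hu : IsUnit h := PowerSeries.isUnit_iff_constantCoeff.mpr hh
  -- `r = 𝒩^{(n)} h / h ≡ 1 (mod π)`
  set r : PowerSeries (LTCoeff F) := colemanNormIter hπ m n h * ↑hu.unit⁻¹ with hr
  have hr1 : r - 1 ∈ coeffIdeal (Ideal.span {LTCoeff.of F π}) := by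
    have e : r - 1 = (colemanNormIter hπ m n h - h) * ↑hu.unit⁻¹ := by
      rw [sub_mul, IsUnit.mul_val_inv, hr]
    rw [e]
    exact Ideal.mul_mem_right _ _ (colemanNormIter_sub_mem_coeffIdeal hπ m n h)
  have hnr : colemanNormIter hπ m n h = h * r := by
    rw [hr, mul_left_comm, IsUnit.mul_val_inv, mul_one]
  -- `𝒩^{(m)} h = 𝒩^{(m-n)} h · w`, `w = 𝒩^{(m-n)} r ≡ 1 (mod π^{m-n+1})`
  set w : PowerSeries (LTCoeff F) := colemanNormIter hπ m (m - n) r with hw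
  have hw1 : w - 1 ∈ coeffIdeal (Ideal.span {LTCoeff.of F π ^ (m - n + 1)}) :=
    colemanNormIter_sub_one_mem hπ m (m - n) hr1
  have hsplit : colemanNormIter hπ m m h = colemanNormIter hπ m (m - n) h * w := by
    have e : colemanNormIter hπ m ((m - n) + n) h = colemanNormIter hπ m (m - n) (colemanNormIter hπ m n h) :=
      Function.iterate_add_apply _ _ _ _
    rw [Nat.sub_add_cancel hnm] at e
    rw [e, hnr, colemanNormIter_mul]
  -- the point `ω_{n+1}` inside `K_π^{m+1}` is `[π^{m-n}] ω_{m+1}`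
  have hpt : inclPt (ltField_mono hπ hnm) (cohPt hπ n) =
      ltAct hπ m (π ^ (m - n)) (ltAct hπ m (cohUnit hπ m : 𝒪[F]) (genPt hπ m)) :=
    (ltAct_pow_sub_cohPt hπ hnm).symm
  -- (2): the value of `𝒩^{(m-n)} h` at `ω_{n+1}` is the product over the stabiliser, i.e. `y'`
  have h2 : ((evalAt (maxNilIdeal F (ltField π m)) (inclPt (ltField_mono hπ hnm) (cohPt hπ n))
      (colemanNormIter hπ m (m - n) h) : unitBall (ltField π m)) : ltField π m) = y' := by
    rw [← hy', hpt, ← prod_stabilizer_algEquiv_evalAt hπ m (cohUnit hπ m) (by omega : m - n ≤ m) h]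
    rfl
  -- the value of `w` at the point is `1 + O(π^{m-n+1})`
  have h3 : ‖((evalAt (maxNilIdeal F (ltField π m)) (inclPt (ltField_mono hπ hnm) (cohPt hπ n)) w :
      unitBall (ltField π m)) : ltField π m) - 1‖ ≤ ‖(π : F)‖ ^ (m - n + 1) := by
    have e := norm_evalAt_le_of_mem_coeffIdeal hπ (E := ltField π m) hw1
      (inclPt (ltField_mono hπ hnm) (cohPt hπ n))
    rwa [map_sub, map_one, AddSubgroupClass.coe_sub, OneMemClass.coe_one] at e
  rw [hsplit, map_mul, Subring.coe_mul, h2]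
  have e2 : y' * ((evalAt (maxNilIdeal F (ltField π m)) (inclPt (ltField_mono hπ hnm) (cohPt hπ n)) w :
      unitBall (ltField π m)) : ltField π m) - y' =
      y' * (((evalAt (maxNilIdeal F (ltField π m)) (inclPt (ltField_mono hπ hnm) (cohPt hπ n)) w :
        unitBall (ltField π m)) : ltField π m) - 1) := by ring
  rw [e2, norm_mul]
  have hy'le : ‖y'‖ ≤ 1 := by
    rw [← h2]; exact norm_coe_unitBall_le _
  calc ‖y'‖ * _ ≤ 1 * ‖(π : F)‖ ^ (m - n + 1) := mul_le_mul hy'le h3 (norm_nonneg _) zero_le_one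
    _ = _ := one_mul _

/-! ### The interpolation theorem -/

omit hπ in
/-- The inclusion `𝒪_{E₁} → 𝒪_{E₂}` is injective. [cite: deShalit1987, Ch. I §1.8] -/
theorem inclUnitBall_injective {E₁ E₂ : IntermediateField F (AlgebraicClosure F)} [FiniteDimensional F E₁]
    [FiniteDimensional F E₂] (h : E₁ ≤ E₂) : Function.Injective (inclUnitBall (F := F) h) := by
  intro x y hxy
  have h1 := congrArg (fun z : unitBall E₂ => ((z : E₂) : AlgebraicClosure F)) hxy
  exact Subtype.ext (Subtype.ext h1)

omit hπ in
/-- The inclusion `𝒪_{E₁} → 𝒪_{E₂}` is an isometry. [cite: SerreLocalFields1979, Ch. II §2 Cor. 3] -/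
theorem norm_inclUnitBall {E₁ E₂ : IntermediateField F (AlgebraicClosure F)} [FiniteDimensional F E₁]
    [FiniteDimensional F E₂] (h : E₁ ≤ E₂) (x : unitBall E₁) :
    ‖((inclUnitBall h x : unitBall E₂) : E₂)‖ = ‖(x : E₁)‖ :=
  norm_inclusion h (x : E₁)

open scoped Classical in
/-- ★ **Coleman's interpolation theorem, existence and `𝒩`-invariance** (de Shalit I §2.2 Theorem;
Coleman 1979 Thm. A; absolute case, `f = πX + X^q`, any residue characteristic). Let `β_m ∈ 𝒪_{K_π^{m+1}}`
be units forming a NORM-COHERENT sequence along the generator `(ω_{m+1}) = (cohPt hπ m)` of the Tate module: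
for `n ≤ m`, the product of `σ β_m` over `{σ ∈ Gal(K_π^{m+1}/F) : σ ω_{n+1} = ω_{n+1}} = Gal(K_π^{m+1}/K_π^{n+1})`
is `β_n`. Then there is `g ∈ 𝒪_F⟦X⟧` with **`g(ω_{m+1}) = β_m` for all `m`** and **`𝒩 g = g`**.
[cite: deShalit1987, Ch. I §2.2 Theorem] -/
theorem exists_evalAt_cohPt_eq (β : ∀ m : ℕ, unitBall (ltField π m))
    (hβ : ∀ m, ‖((β m : unitBall (ltField π m)) : ltField π m)‖ = 1)
    (hcoh : ∀ n m (hnm : n ≤ m),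
      ∏ σ ∈ Finset.univ.filter (fun σ : ltField π m ≃ₐ[F] ltField π m =>
          mapPt σ (inclPt (ltField_mono hπ hnm) (cohPt hπ n)) = inclPt (ltField_mono hπ hnm) (cohPt hπ n)),
        σ ((β m : unitBall (ltField π m)) : ltField π m) =
        ((inclUnitBall (ltField_mono hπ hnm) (β n) : unitBall (ltField π m)) : ltField π m)) :
    ∃ g : PowerSeries (LTCoeff F), colemanNorm hπ 0 g = g ∧
      ∀ m, evalAt (maxNilIdeal F (ltField π m)) (cohPt hπ m) g = β m := by
  -- Step 1: unit series `h_m` with `h_m(ω_{m+1}) = β_m`, and `g_m = 𝒩^{(m)} h_m`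
  have hex : ∀ m, ∃ h : PowerSeries (LTCoeff F), IsUnit (PowerSeries.constantCoeff h) ∧
      ((evalAt (maxNilIdeal F (ltField π m)) (cohPt hπ m) h : unitBall (ltField π m)) : ltField π m) =
        β m := fun m => exists_isUnit_evalAt_ltAct_eq hπ m (cohUnit hπ m) _ (hβ m)
  choose h hh1 hh2 using hex
  set gs : ℕ → PowerSeries (LTCoeff F) := fun m => colemanNormIter hπ m m (h m) with hgs
  -- Step 2: the key estimate `‖g_m(ω_{n+1}) - β_n‖ ≤ ‖π‖^{m-n+1}` (in `K_π^{m+1}`)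
  have hest : ∀ n m (hnm : n ≤ m),
      ‖((evalAt (maxNilIdeal F (ltField π m)) (inclPt (ltField_mono hπ hnm) (cohPt hπ n)) (gs m) :
        unitBall (ltField π m)) : ltField π m) -
        ((inclUnitBall (ltField_mono hπ hnm) (β n) : unitBall (ltField π m)) : ltField π m)‖ ≤
      ‖(π : F)‖ ^ (m - n + 1) := by
    intro n m hnm
    refine norm_evalAt_colemanNormIter_sub_le hπ hnm (hh1 m) ?_
    rw [← hcoh n m hnm]
    exact Finset.prod_congr rfl fun σ _ => by rw [hh2 m]
  -- Step 3: a cluster point of the coefficient vectors in the compact space `𝒪_F^ℕ`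
  set c : ℕ → ℕ → 𝒪[F] := fun m k => (LTCoeff.of F).symm (PowerSeries.coeff k (gs m)) with hc
  obtain ⟨x, hx⟩ : ∃ x : ℕ → 𝒪[F], MapClusterPt x atTop c :=
    exists_clusterPt_of_compactSpace (map c atTop)
  set g : PowerSeries (LTCoeff F) := PowerSeries.mk fun k => LTCoeff.of F (x k) with hg
  have hclose : ∀ K a : ℕ, ∃ᶠ m in atTop, ∀ k < K,
      LTCoeff.of F π ^ a ∣ PowerSeries.coeff k g - PowerSeries.coeff k (gs m) := by
    intro K a
    refine (exists_frequently_close hπ hx K a).mono fun m hm k hk => ?_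
    obtain ⟨d, hd⟩ := hm k hk
    refine ⟨-(LTCoeff.of F d), ?_⟩
    have e1 : PowerSeries.coeff k (gs m) = LTCoeff.of F (c m k) := (RingEquiv.apply_symm_apply _ _).symm
    have e2 : PowerSeries.coeff k g = LTCoeff.of F (x k) := by rw [hg, PowerSeries.coeff_mk]
    have e3 : x k - c m k = -(π ^ a * d) := by rw [← hd]; ring
    rw [e1, e2, ← map_sub, e3, map_neg, map_mul, map_pow, mul_neg]
  -- Step 4: `g(ω_{n+1}) = β_n`
  have hπlt : ‖(π : F)‖ < 1 := Valued.toNormedField.norm_lt_one_iff.mpr hπ.val_lt_one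
  have hπpos : 0 < ‖(π : F)‖ := norm_pos_iff.mpr hπ.ne_zero
  have hval : ∀ n, evalAt (maxNilIdeal F (ltField π n)) (cohPt hπ n) g = β n := by
    intro n
    -- it suffices to show that the distance is `< ε` for every `ε > 0`
    apply Subtype.ext
    apply eq_of_norm_sub_le_zero
    refine le_of_forall_pos_lt_add fun ε hε => ?_
    rw [zero_add]
    obtain ⟨a, ha⟩ := exists_pow_lt_of_lt_one hε hπlt
    have hωlt : ‖(((cohPt hπ n : (maxNilIdeal F (ltField π n)).toIdeal) : unitBall (ltField π n)) :
        ltField π n)‖ < 1 := (cohPt hπ n).2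
    obtain ⟨K, hK⟩ := exists_pow_lt_of_lt_one hε hωlt
    obtain ⟨m, hm, hmn⟩ := ((hclose K a).and_eventually (eventually_ge_atTop (n + a))).exists
    have hnm : n ≤ m := by omega
    -- move to `K_π^{m+1}`
    have hι : ((inclUnitBall (ltField_mono hπ hnm) (evalAt (maxNilIdeal F (ltField π n)) (cohPt hπ n) g -
        β n) : unitBall (ltField π m)) : ltField π m) =
        ((evalAt (maxNilIdeal F (ltField π m)) (inclPt (ltField_mono hπ hnm) (cohPt hπ n)) g :
          unitBall (ltField π m)) : ltField π m) -
        ((inclUnitBall (ltField_mono hπ hnm) (β n) : unitBall (ltField π m)) : ltField π m) := by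
      rw [map_sub, AddSubgroupClass.coe_sub, inclUnitBall_evalAt]
    rw [← AddSubgroupClass.coe_sub, ← norm_inclUnitBall (ltField_mono hπ hnm), hι]
    -- split through `g_m(ω_{n+1})`
    have hA := norm_evalAt_sub_le_of_forall_lt (E := ltField π m) (G := g) (G' := gs m) hm
      (inclPt (ltField_mono hπ hnm) (cohPt hπ n))
    have hB := hest n m hnm
    have hωeq : ‖((((inclPt (ltField_mono hπ hnm) (cohPt hπ n)) : (maxNilIdeal F (ltField π m)).toIdeal) :
        unitBall (ltField π m)) : ltField π m)‖ =
        ‖(((cohPt hπ n : (maxNilIdeal F (ltField π n)).toIdeal) : unitBall (ltField π n)) : ltField π n)‖ :=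
      norm_inclUnitBall (ltField_mono hπ hnm) _
    rw [hωeq] at hA
    have hA' : max (‖(π : F)‖ ^ a) (‖(((cohPt hπ n : (maxNilIdeal F (ltField π n)).toIdeal) :
        unitBall (ltField π n)) : ltField π n)‖ ^ K) < ε := max_lt ha hK
    have hB' : ‖(π : F)‖ ^ (m - n + 1) < ε :=
      lt_of_le_of_lt (pow_le_pow_of_le_one hπpos.le hπlt.le (by omega)) ha
    have htri := IsUltrametricDist.dist_triangle_max
      (((evalAt (maxNilIdeal F (ltField π m)) (inclPt (ltField_mono hπ hnm) (cohPt hπ n)) g :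
        unitBall (ltField π m)) : ltField π m))
      (((evalAt (maxNilIdeal F (ltField π m)) (inclPt (ltField_mono hπ hnm) (cohPt hπ n)) (gs m) :
        unitBall (ltField π m)) : ltField π m))
      (((inclUnitBall (ltField_mono hπ hnm) (β n) : unitBall (ltField π m)) : ltField π m))
    rw [dist_eq_norm, dist_eq_norm, dist_eq_norm] at htri
    exact lt_of_le_of_lt htri (max_lt (lt_of_le_of_lt hA hA') (lt_of_le_of_lt hB hB'))
  refine ⟨g, ?_, hval⟩
  -- Step 5: `𝒩 g = g`, by uniqueness: `𝒩 g - g` vanishes at every `ω_{n+1}`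
  refine sub_eq_zero.mp (eq_zero_of_frequently_evalAt_ltSMul_genPt_eq_zero hπ
    (fun n => (cohUnit hπ n : 𝒪[F])) (fun n => (cohUnit hπ n).isUnit) (Filter.Frequently.of_forall fun n => ?_))
  change evalAt (maxNilIdeal F (ltField π n)) (cohPt hπ n) (colemanNorm hπ 0 g - g) = 0
  rw [map_sub, sub_eq_zero, colemanNorm_level_eq hπ 0 (n + 1)]
  -- compare inside `K_π^{n+2}` at `ι ω_{n+1} = [π] ω_{n+2}`
  have hs : n ≤ n + 1 := Nat.le_succ n
  apply inclUnitBall_injective (ltField_mono hπ hs)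
  rw [inclUnitBall_evalAt, inclUnitBall_evalAt]
  apply Subtype.ext
  have hpt : inclPt (ltField_mono hπ hs) (cohPt hπ n) =
      ltAct hπ (n + 1) (π ^ 1) (ltAct hπ (n + 1) (cohUnit hπ (n + 1) : 𝒪[F]) (genPt hπ (n + 1))) := by
    rw [← ltAct_pow_sub_cohPt hπ hs, Nat.add_sub_cancel_left]
    rfl
  have h2 := prod_stabilizer_algEquiv_evalAt hπ (n + 1) (cohUnit hπ (n + 1)) (k := 1) (by omega) g
  rw [← hpt, ← cohPt_eq, colemanNormIter_succ, colemanNormIter_zero] at h2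
  rw [← h2, hval (n + 1), hcoh n (n + 1) hs, ← inclUnitBall_evalAt, hval n]

/-- **Coleman's interpolation theorem, uniqueness**: two series taking the same values at `ω_{m+1}` for
infinitely many `m` are equal (`LubinTateColemanZeros.lean`). [cite: deShalit1987, Ch. I §2.2 Theorem] -/
theorem eq_of_frequently_evalAt_cohPt_eq {g g' : PowerSeries (LTCoeff F)}
    (h : ∃ᶠ m in atTop, evalAt (maxNilIdeal F (ltField π m)) (cohPt hπ m) g =
      evalAt (maxNilIdeal F (ltField π m)) (cohPt hπ m) g') : g = g' :=
  eq_of_frequently_evalAt_ltSMul_genPt_eq hπ (fun n => (cohUnit hπ n : 𝒪[F]))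
    (fun n => (cohUnit hπ n).isUnit) h

/-- **Coleman's interpolation theorem, uniqueness (all levels)**. [cite: deShalit1987, Ch. I §2.2 Theorem] -/
theorem eq_of_forall_evalAt_cohPt_eq {g g' : PowerSeries (LTCoeff F)}
    (h : ∀ m, evalAt (maxNilIdeal F (ltField π m)) (cohPt hπ m) g =
      evalAt (maxNilIdeal F (ltField π m)) (cohPt hπ m) g') : g = g' :=
  eq_of_frequently_evalAt_cohPt_eq hπ (Filter.Frequently.of_forall h)

/-! ### Galois equivariance: `g ↦ g ∘ [v]_f` versus `σ_v` on the values -/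

/-- **Galois equivariance of the interpolation (de Shalit Cor. 2.3 (iv))**: for a unit `v ∈ 𝒪_Fˣ` and the
automorphism `σ_v` of `K_π^{m+1}` with `σ_v λ_{m+1} = [v] λ_{m+1}` (`galOfUnit`),
`(g ∘ [v]_f)(ω_{m+1}) = σ_v(g(ω_{m+1}))`; so if `g` interpolates `β` then `g ∘ [v]_f` interpolates `(σ_v β_m)_m`,
i.e. `g_{σβ} = g_β ∘ [κ(σ)]_f`. [cite: deShalit1987, Ch. I §2.3 (iv)] -/
theorem evalAt_cohPt_subst_hom (v : 𝒪[F]ˣ) (g : PowerSeries (LTCoeff F)) (m : ℕ) :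
    ((evalAt (maxNilIdeal F (ltField π m)) (cohPt hπ m)
        (PowerSeries.subst (hom (isLTRing_LTCoeff hπ) (isLTSeries_LTCoeff π) (isLTSeries_LTCoeff π)
          (LTCoeff.of F (v : 𝒪[F]))) g) : unitBall (ltField π m)) : ltField π m) =
      galOfUnit hπ m v (((evalAt (maxNilIdeal F (ltField π m)) (cohPt hπ m) g : unitBall (ltField π m)) :
        ltField π m)) := by
  rw [evalAt_subst_hom hπ, algEquiv_evalAt, cohPt_eq, mapPt_ltAct', mapPt_galOfUnit_genPt, ltAct_comm]

end LocalFieldI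

end Literature.NumberTheory.GaloisRepresentations
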